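import Summits.Langlands.Langlands.Theorems.ParityBlindBianchiTwoAdicBianchiProModularityLevelTameLevelMonotone
import HarnessLib

/-!
# `TwoAdicBianchiProModularityLevel` (crux stmt-Langlands-15110, route `ParityBlindBianchi`) —
# THE COMPONENT OF THE TAME LEVEL AT THE PLACES OVER 2 IS IRRELEVANT

In the crux (E2′) and in stub B the tame level `U ≤ GL₂(𝒪̂_K)` is a subgroup of the full finite-adelic
group, with a component at the places over `2`, while the tower `s ↦ U ∩ K_f((2)^s)` exhausts the
`2`-power principal congruence subgroups anyway.  Here it is kernel-checked that the points of `Spf 𝕋(U²)`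
do not see that component:

* `IsHeckePoint.of_level_eq` (generic) — if every level of `T'` IS a level of `T` (`K'(s) = K(f s)`), the
  pieces of `T'` are pieces of `T`, so every point of `Spf 𝕋(T')` is a point of `Spf 𝕋(T)`;
* `comap_principalCongruenceLevel_two_pow_inf` — `K_f((2)^c) ∩ K_f((2)^s) = K_f((2)^{max c s})`;
* `crux_isHeckePoint_iff_inf_two_pow` (registered sub-goal) — **for `U` open, `U ≤ GL₂(𝒪̂_K)`, with the
  third level clause (`2 ∈ S₀`), Hecke data `a` are a point of `Spf 𝕋(U²)` iff they are a point of
  `Spf 𝕋((U ∩ K_f((2)^c))²)`**, for every `c` (`→`: tame-level monotonicity, `crux_isHeckePoint_of_le_tameLevel`;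
  `←`: the tower of `U ∩ K_f((2)^c)` is the tower of `U` re-indexed by `s ↦ max c s`).  Consequently two
  admissible tame levels that agree inside some `K_f((2)^c)` carry the same points: the conclusion of B /
  E2′ depends on `U` only through its prime-to-`2` part, as the informal "`𝕋(Uᵖ)`" intends.

Sorry-free, definition-free; lead c11 (line `Sketch`, cycle 12).
-/

noncomputable section

set_option linter.dupNamespace false

namespace Summit.Langlands.Langlands.Theorems.TwoAdicBianchiProModularityLevel

open CategoryTheory Literature.NumberTheory.Automorphic BigHeckeGLn
open scoped NumberField
open IsDedekindDomain

universe v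

/-! ### Generic: a tower whose levels are levels of another tower -/

section Generic

variable {k : Type} [CommRing k] {Γ 𝒢 : Type} [Group Γ] [Group 𝒢]
  {ι : Γ →* 𝒢} {T T' : LevelTower 𝒢} {ϖ : k} {J : Type v} {δ : J → 𝒢} {χ : J → k}

variable (ι δ) in
/-- Vanishing of an abstract Hecke operator on `H^i(X_L, M)` only depends on the level `L` as a subgroup
(transport along an equality of levels). [folklore] -/
theorem lift_heckeEnd_eq_zero_of_eq {L L' : Subgroup 𝒢} (h : L' = L) (M : Type) [AddCommGroup M]
    [Module k M] (i : ℕ) (P : FreeAlgebra k J)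
    (hP : FreeAlgebra.lift k (fun j => ArithmeticQuotient.heckeEnd k L (δ j) M ι i) P = 0) :
    FreeAlgebra.lift k (fun j => ArithmeticQuotient.heckeEnd k L' (δ j) M ι i) P = 0 := by
  subst h
  exact hP

/-- **Points of a tower whose levels are levels of `T` are points of `T`.**  If `K'(s) = K(f s)` for all
`s`, then the pieces `H^i(X_{K'(s)}, k/ϖ^t)` of `T'` are the pieces `(i, f s, t)` of `T`, so the
continuity condition defining a point of `Spf 𝕋(T')` (a finite set of pieces of `T'` controlling
`χ mod ϖ^t`, `isHeckePoint_iff_forall_freeAlgebra`) is a continuity condition for `T`. [folklore] -/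
theorem IsHeckePoint.of_level_eq (f : ℕ → ℕ) (heq : ∀ s, T'.level s = T.level (f s))
    (h : IsHeckePoint ι T' ϖ δ χ) : IsHeckePoint ι T ϖ δ χ := by
  classical
  rw [isHeckePoint_iff_forall_freeAlgebra] at h ⊢
  intro t
  obtain ⟨I', hI'⟩ := h t
  refine ⟨I'.image (fun z : TowerIndex => ((z.1, f z.2.1, z.2.2) : TowerIndex)), fun P hP => hI' P fun z hz => ?_⟩
  have hz' := hP (z.1, f z.2.1, z.2.2) (Finset.mem_image_of_mem _ hz)
  rw [lift_towerHeckeFamily_apply] at hz' ⊢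
  exact lift_heckeEnd_eq_zero_of_eq ι δ (heq z.2.1) _ _ P hz'

end Generic

/-! ### The principal congruence levels at 2 -/

variable {K : Type} [Field K] [NumberField K]

/-- `K_f((2)^c) ∩ K_f((2)^s) = K_f((2)^{max c s})`. [folklore] -/
theorem comap_principalCongruenceLevel_two_pow_inf {n : ℕ} (c s : ℕ) :
    (principalCongruenceLevel n K (Ideal.span {((2 : ℕ) : 𝓞 K)} ^ c)).comap (GLn.ofFinite n K) ⊓
        (principalCongruenceLevel n K (Ideal.span {((2 : ℕ) : 𝓞 K)} ^ s)).comap (GLn.ofFinite n K) =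
      (principalCongruenceLevel n K (Ideal.span {((2 : ℕ) : 𝓞 K)} ^ max c s)).comap (GLn.ofFinite n K) := by
  refine le_antisymm ?_ (le_inf (comap_principalCongruenceLevel_pow_anti span_two_ne_zero (le_max_left c s))
    (comap_principalCongruenceLevel_pow_anti span_two_ne_zero (le_max_right c s)))
  rcases le_total c s with h | h
  · rw [max_eq_right h]; exact inf_le_right
  · rw [max_eq_left h]; exact inf_le_left

/-- The tower of `U ∩ K_f((2)^c)` is the tower of `U` re-indexed by `s ↦ max c s`. [folklore] -/
theorem ofSeq_inf_two_pow_level {n : ℕ} (U : Subgroup (FiniteAdelicGL n K)) (c s : ℕ) :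
    (LevelTower.ofSeq (U ⊓ (principalCongruenceLevel n K (Ideal.span {((2 : ℕ) : 𝓞 K)} ^ c)).map
        (GLn.sndHom n K)) fun r : ℕ =>
          (principalCongruenceLevel n K (Ideal.span {((2 : ℕ) : 𝓞 K)} ^ r)).map (GLn.sndHom n K)).level s =
      (LevelTower.ofSeq U fun r : ℕ =>
        (principalCongruenceLevel n K (Ideal.span {((2 : ℕ) : 𝓞 K)} ^ r)).map (GLn.sndHom n K)).level
        (max c s) := by
  rw [ofSeq_comap_principalCongruenceLevel_pow_level span_two_ne_zero,
    ofSeq_comap_principalCongruenceLevel_pow_level span_two_ne_zero, map_sndHom_principalCongruenceLevel,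
    inf_assoc, comap_principalCongruenceLevel_two_pow_inf]

/-- `U ∩ K_f((2)^c)` satisfies the third level clause when `U` does (`2 ∈ S₀`: the places dividing
`(2)^c` are bad). [folklore] -/
theorem goodClause_inf_two_pow {n : ℕ} {S₀ : Finset ℕ} (h2 : 2 ∈ S₀) {U : Subgroup (FiniteAdelicGL n K)}
    (hcl : ∀ g ∈ glFiniteIntegralLevel n K,
      (∀ w : HeightOneSpectrum (𝓞 K), ¬ (∀ ℓ ∈ S₀, ((ℓ : ℕ) : 𝓞 K) ∉ w.asIdeal) →
        ∀ i j : Fin n, ((g : Matrix (Fin n) (Fin n) (FiniteAdeleRing (𝓞 K) K)) i j) w =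
          (1 : Matrix (Fin n) (Fin n) (w.adicCompletion K)) i j) → g ∈ U) (c : ℕ) :
    ∀ g ∈ glFiniteIntegralLevel n K,
      (∀ w : HeightOneSpectrum (𝓞 K), ¬ (∀ ℓ ∈ S₀, ((ℓ : ℕ) : 𝓞 K) ∉ w.asIdeal) →
        ∀ i j : Fin n, ((g : Matrix (Fin n) (Fin n) (FiniteAdeleRing (𝓞 K) K)) i j) w =
          (1 : Matrix (Fin n) (Fin n) (w.adicCompletion K)) i j) →
      g ∈ U ⊓ (principalCongruenceLevel n K (Ideal.span {((2 : ℕ) : 𝓞 K)} ^ c)).map (GLn.sndHom n K) := by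
  intro g hg hgS
  refine ⟨hcl g hg hgS, ?_⟩
  rw [map_sndHom_principalCongruenceLevel]
  refine mem_comap_principalCongruenceLevel_of_localComponent (pow_ne_zero c span_two_ne_zero) hg
    fun w hw => ?_
  have hbad : ¬ (∀ ℓ ∈ S₀, ((ℓ : ℕ) : 𝓞 K) ∉ w.asIdeal) := fun hgood => not_dvd_span_two_pow h2 hgood c hw
  exact Matrix.GeneralLinearGroup.ext fun i j => by
    rw [coe_localComponent_apply, hgS w hbad i j, Units.val_one]

/-- `U ∩ K_f((2)^c)` is open for `U` open. [folklore] -/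
theorem isOpen_inf_two_pow {n : ℕ} {U : Subgroup (FiniteAdelicGL n K)} (hUo : IsOpen (U : Set (FiniteAdelicGL n K)))
    (c : ℕ) :
    IsOpen ((U ⊓ (principalCongruenceLevel n K (Ideal.span {((2 : ℕ) : 𝓞 K)} ^ c)).map (GLn.sndHom n K) :
      Subgroup (FiniteAdelicGL n K)) : Set (FiniteAdelicGL n K)) := by
  rw [map_sndHom_principalCongruenceLevel]
  exact isOpen_inf_comap_principalCongruenceLevel hUo (pow_ne_zero c span_two_ne_zero)

/-! ### The crux form -/

/-- **The points of `Spf 𝕋(U²)` do not see the component of `U` at the places over `2`** (registered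
sub-goal): for `2 ∈ S₀`, `U` open, `U ≤ GL₂(𝒪̂_K)`, satisfying the third level clause, and any `c`, Hecke
data `a` are a point of `Spf 𝕋` of the tower `s ↦ U ∩ K_f((2)^s)` iff they are a point of `Spf 𝕋` of the
tower of `U ∩ K_f((2)^c)` — `→` by tame-level monotonicity (`crux_isHeckePoint_of_le_tameLevel`), `←` because
the second tower is the first re-indexed by `s ↦ max c s` (`IsHeckePoint.of_level_eq`).
[cite: CalegariEmerton2011, §5] [cite: ShimuraIATAF1971, Ch. 3, Prop. 3.1] -/
theorem crux_isHeckePoint_iff_inf_two_pow : ∀ (K : Type) [Field K] [NumberField K] (S₀ : Finset ℕ),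
    2 ∈ S₀ →
    ∀ (ϖ : ∀ v : HeightOneSpectrum (𝓞 K), (v.adicCompletion K)ˣ)
      (a : {v : HeightOneSpectrum (𝓞 K) // ∀ ℓ ∈ S₀, ((ℓ : ℕ) : 𝓞 K) ∉ v.asIdeal} → ℕ →
        (PadicAlgCl.valued 2).v.valuationSubring)
      (U : Subgroup (GL (Fin 2) (FiniteAdeleRing (𝓞 K) K))) (c : ℕ),
    IsOpen (U : Set (GL (Fin 2) (FiniteAdeleRing (𝓞 K) K))) → U ≤ glFiniteIntegralLevel 2 K →
    (∀ g ∈ glFiniteIntegralLevel 2 K,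
      (∀ v : HeightOneSpectrum (𝓞 K), ¬ (∀ ℓ ∈ S₀, ((ℓ : ℕ) : 𝓞 K) ∉ v.asIdeal) →
        ∀ i j : Fin 2, ((g : Matrix (Fin 2) (Fin 2) (FiniteAdeleRing (𝓞 K) K)) i j) v =
          (1 : Matrix (Fin 2) (Fin 2) (v.adicCompletion K)) i j) → g ∈ U) →
    (IsHeckePoint
      (Matrix.GeneralLinearGroup.map (algebraMap K (FiniteAdeleRing (𝓞 K) K)) :
        GL (Fin 2) K →* GL (Fin 2) (FiniteAdeleRing (𝓞 K) K))
      (LevelTower.ofSeq U (fun r : ℕ =>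
        (principalCongruenceLevel 2 K (Ideal.span {((2 : ℕ) : 𝓞 K)} ^ r)).map (GLn.sndHom 2 K)))
      ((2 : ℕ) : (PadicAlgCl.valued 2).v.valuationSubring)
      (fun j : {v : HeightOneSpectrum (𝓞 K) // ∀ ℓ ∈ S₀, ((ℓ : ℕ) : 𝓞 K) ∉ v.asIdeal} × Fin 2 =>
        GLn.sndHom 2 K (heckeDiagAt 2 K j.1.1 (ϖ j.1.1) (j.2.val + 1)))
      (fun j => a j.1 (j.2.val + 1)) ↔
    IsHeckePoint
      (Matrix.GeneralLinearGroup.map (algebraMap K (FiniteAdeleRing (𝓞 K) K)) :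
        GL (Fin 2) K →* GL (Fin 2) (FiniteAdeleRing (𝓞 K) K))
      (LevelTower.ofSeq (U ⊓ (principalCongruenceLevel 2 K (Ideal.span {((2 : ℕ) : 𝓞 K)} ^ c)).map
          (GLn.sndHom 2 K)) (fun r : ℕ =>
        (principalCongruenceLevel 2 K (Ideal.span {((2 : ℕ) : 𝓞 K)} ^ r)).map (GLn.sndHom 2 K)))
      ((2 : ℕ) : (PadicAlgCl.valued 2).v.valuationSubring)
      (fun j : {v : HeightOneSpectrum (𝓞 K) // ∀ ℓ ∈ S₀, ((ℓ : ℕ) : 𝓞 K) ∉ v.asIdeal} × Fin 2 =>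
        GLn.sndHom 2 K (heckeDiagAt 2 K j.1.1 (ϖ j.1.1) (j.2.val + 1)))
      (fun j => a j.1 (j.2.val + 1))) := by
  intro K _ _ S₀ h2 ϖ a U c hUo hU hcl
  constructor
  · exact crux_isHeckePoint_of_le_tameLevel K S₀ h2 ϖ a U _ inf_le_left hUo (isOpen_inf_two_pow hUo c) hU
      (goodClause_inf_two_pow h2 hcl c)
  · exact IsHeckePoint.of_level_eq (fun s => max c s) (fun s => ofSeq_inf_two_pow_level U c s)

end Summit.Langlands.Langlands.Theorems.TwoAdicBianchiProModularityLevel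

end
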